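import Mathlib
import Literature.NumberTheory.GaloisRepresentations.Pseudocharacter
import HarnessLib

/-!
# Taylor's kernel of a linear pseudocharacter and the non-degenerate quotient

Topic `NumberTheory/GaloisRepresentations`; part 2 of the proof of Taylor's theorem
(`Hida2000_thm_2_18_1`).

For a `k`-linear form `T` on a `k`-algebra `R`:

* `traceKer T` — **Taylor's kernel** `{a | T(b a c) = 0 ∀ b c}`, a two-sided ideal
  (`Ideal.IsTwoSided`), equal to `{a | T(a b) = 0 ∀ b}` for central `T` (`mem_traceKer_iff`)
  [cite: Taylor1991, §1], [cite: BellaicheChenevier2009, §1.2];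
* `traceKerLift T : (R ⧸ ker T) →ₗ[k] k` — the descended form, `traceKerLift_mk`;
* `traceKerLift_nondegenerate` — it is **non-degenerate**;
* `IsPseudocharacter.traceKerLift` — if `T` is a pseudocharacter of dimension `d` of the
  multiplicative monoid of `R`, so is the descended form on `R ⧸ ker T`.

## References

* R. Taylor, Duke Math. J. 63 (1991), §1 [Taylor1991].
* J. Bellaïche, G. Chenevier, *Families of Galois representations and Selmer groups*, Astérisque
  324 (2009), §1.2 [BellaicheChenevier2009].
-/

namespace Literature.NumberTheory.GaloisRepresentations

open Function

universe u v

section Kernel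

variable {k : Type u} [CommRing k] {R : Type v} [Ring R] [Algebra k R]

/-- **Taylor's kernel** of a linear form `T` on an algebra `R`: the two-sided ideal
`ker T = {a | T(b a c) = 0 for all b, c}`; for central `T` this is `{a | T(a b) = 0 for all b}`
(`mem_traceKer_iff`). [cite: Taylor1991, §1], [cite: BellaicheChenevier2009, §1.2] -/
def traceKer (T : R →ₗ[k] k) : Ideal R where
  carrier := {a | ∀ b c : R, T (b * a * c) = 0}
  zero_mem' := by intro b c; simp
  add_mem' {x y} hx hy := by
    intro b c
    rw [mul_add, add_mul, map_add, hx, hy, add_zero]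
  smul_mem' r {x} hx := by
    intro b c
    rw [smul_eq_mul, ← mul_assoc b r x, hx]

/-- Membership in Taylor's kernel (definition). [folklore] -/
lemma mem_traceKer {T : R →ₗ[k] k} {a : R} : a ∈ traceKer T ↔ ∀ b c : R, T (b * a * c) = 0 :=
  Iff.rfl

/-- Taylor's kernel is a two-sided ideal. [folklore] -/
instance traceKer_isTwoSided (T : R →ₗ[k] k) : (traceKer T).IsTwoSided :=
  ⟨fun {x} y hx => by
    intro b c
    rw [show b * (x * y) * c = b * x * (y * c) by noncomm_ring]
    exact hx b (y * c)⟩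

/-- For a central `T`, `a ∈ ker T ↔ T(a b) = 0` for all `b`. [cite: Taylor1991, §1] -/
lemma mem_traceKer_iff {T : R →ₗ[k] k} (hc : ∀ x y : R, T (x * y) = T (y * x)) {a : R} :
    a ∈ traceKer T ↔ ∀ b : R, T (a * b) = 0 := by
  refine ⟨fun h b => by simpa using h 1 b, fun h b c => ?_⟩
  rw [mul_assoc, hc, mul_assoc]
  exact h _

/-- Elements of the kernel are `T`-null. [folklore] -/
lemma apply_eq_zero_of_mem_traceKer {T : R →ₗ[k] k} {a : R} (ha : a ∈ traceKer T) : T a = 0 := by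
  simpa using ha 1 1

/-- **The form `T` descends to the quotient `R ⧸ ker T`** (a `k`-linear map). [cite: Taylor1991, §1] -/
noncomputable def traceKerLift (T : R →ₗ[k] k) : (R ⧸ traceKer T) →ₗ[k] k :=
  ((traceKer T).restrictScalars k).liftQ T
      (fun _ ha => LinearMap.mem_ker.2 (apply_eq_zero_of_mem_traceKer ha)) ∘ₗ
    (Submodule.Quotient.restrictScalarsEquiv k (traceKer T)).symm.toLinearMap

/-- The descended form on classes. [folklore] -/
@[simp] lemma traceKerLift_mk (T : R →ₗ[k] k) (a : R) :
    traceKerLift T (Ideal.Quotient.mk (traceKer T) a) = T a := by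
  show ((traceKer T).restrictScalars k).liftQ T
      (fun _ ha => LinearMap.mem_ker.2 (apply_eq_zero_of_mem_traceKer ha))
    ((Submodule.Quotient.restrictScalarsEquiv k (traceKer T)).symm (Submodule.Quotient.mk a)) = T a
  rw [Submodule.Quotient.restrictScalarsEquiv_symm_mk, Submodule.liftQ_apply]

/-- The descended form composed with the quotient map is `T`. [folklore] -/
lemma traceKerLift_comp_mk (T : R →ₗ[k] k) :
    ⇑(traceKerLift T) ∘ ⇑(Ideal.Quotient.mk (traceKer T)) = ⇑T :=
  funext (traceKerLift_mk T)

/-- The descended form is central if `T` is. [folklore] -/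
lemma traceKerLift_mul_comm {T : R →ₗ[k] k} (hc : ∀ x y : R, T (x * y) = T (y * x))
    (x y : R ⧸ traceKer T) : traceKerLift T (x * y) = traceKerLift T (y * x) := by
  obtain ⟨x, rfl⟩ := Ideal.Quotient.mk_surjective x
  obtain ⟨y, rfl⟩ := Ideal.Quotient.mk_surjective y
  rw [← map_mul, ← map_mul, traceKerLift_mk, traceKerLift_mk, hc]

/-- **Non-degeneracy of the descended form**: if `T̄(x y) = 0` for all `y` then `x = 0` in
`R ⧸ ker T`. [cite: Taylor1991, §1], [cite: BellaicheChenevier2009, §1.2] -/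
theorem traceKerLift_nondegenerate {T : R →ₗ[k] k} (hc : ∀ x y : R, T (x * y) = T (y * x))
    {x : R ⧸ traceKer T} (h : ∀ y, traceKerLift T (x * y) = 0) : x = 0 := by
  obtain ⟨x, rfl⟩ := Ideal.Quotient.mk_surjective x
  refine Ideal.Quotient.eq_zero_iff_mem.2 ((mem_traceKer_iff hc).2 fun b => ?_)
  have := h (Ideal.Quotient.mk _ b)
  rwa [← map_mul, traceKerLift_mk] at this

/-- Non-degeneracy, left form. [folklore] -/
theorem traceKerLift_nondegenerate' {T : R →ₗ[k] k} (hc : ∀ x y : R, T (x * y) = T (y * x))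
    {x : R ⧸ traceKer T} (h : ∀ y, traceKerLift T (y * x) = 0) : x = 0 :=
  traceKerLift_nondegenerate hc fun y => by rw [traceKerLift_mul_comm hc]; exact h y

/-- **A linear pseudocharacter descends to a (non-degenerate) linear pseudocharacter of
`R ⧸ ker T`** of the same dimension. [cite: Taylor1991, §1], [cite: Rouquier1996, §2] -/
theorem IsPseudocharacter.traceKerLift {T : R →ₗ[k] k} {d : ℕ} (hT : IsPseudocharacter T d) :
    IsPseudocharacter (traceKerLift T) d where
  map_one := by
    rw [← _root_.map_one (Ideal.Quotient.mk (traceKer T)), traceKerLift_mk, hT.map_one]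
  map_mul_comm := traceKerLift_mul_comm hT.map_mul_comm
  frobenius x := by
    obtain ⟨y, rfl⟩ : ∃ y : Fin (d + 1) → R, ⇑(Ideal.Quotient.mk (traceKer T)) ∘ y = x :=
      ⟨fun i => (Ideal.Quotient.mk_surjective (x i)).choose,
        funext fun i => (Ideal.Quotient.mk_surjective (x i)).choose_spec⟩
    rw [← frobeniusS_comp, traceKerLift_comp_mk, hT.frobenius]

/-- The kernel of the descended form is trivial (for central `T`). [folklore] -/
theorem traceKer_traceKerLift_eq_bot {T : R →ₗ[k] k} (hc : ∀ x y : R, T (x * y) = T (y * x)) :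
    traceKer (traceKerLift T) = ⊥ := by
  rw [eq_bot_iff]
  intro x hx
  rw [Submodule.mem_bot]
  exact traceKerLift_nondegenerate hc ((mem_traceKer_iff (traceKerLift_mul_comm hc)).1 hx)

end Kernel

end Literature.NumberTheory.GaloisRepresentations
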